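import Literature.MathematicalPhysics.KineticTheory.Sweep1
import Literature.Analysis.FluidPDE.BoltzmannGradLimitProofs
import Literature.Analysis.FluidPDE.CollisionWeakForm
import HarnessLib

/-!
# Hilbert's sixth problem, statement sweep 1: proofs

Discharge of the named fact `propagatesChaos_imp_tendstoEmpirical_torus` of
`Literature.MathematicalPhysics.KineticTheory.Sweep1` (**hilbert6.S08**, mode A ⇒ mode B on the
flat torus): if the marginals of the transported `N_k`-particle densities of hard spheres on
`T^d × ℝ^d` propagate chaos on `[0, T]` (convergence in the sense of observables, locally
uniformly off the position diagonal, to `f(t)^{⊗s}`, with `f(t)` a probability density), then the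
empirical measure at each time `t ∈ [0, T]` converges in probability to `f(t) dx dv`
(Gallagher–Saint-Raymond–Texier 2013 §2.4; Sznitman 1991 Prop. 2.2 (i)⇒(ii)).

The general statement over a Hausdorff, locally compact, σ-compact Borel position space whose
points are Lebesgue-null is the prelude fact `Literature.Analysis.FluidPDE.TendstoMarginals.tendstoEmpirical`,
discharged in `Literature.Analysis.FluidPDE.BoltzmannGradLimitProofs`
(`TendstoMarginals.tendstoEmpirical_holds`, via Chaintron–Diez 2022 Lemma 3.19). The torus case
is its specialisation `X = UnitAddTorus d`: all standing instances are found by instance search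
except "points are null", which is `Literature.Analysis.FluidPDE.nullSingletonClass_volume_unitAddTorus`
(stated in the prelude as a theorem, not a global instance on a Mathlib type).

(This companion file is SHARED by several discharges: extend it by appending a new section to
the current tree version — never replace it wholesale.)

## 2. `isMildBoltzmannSolutionOn_reversed_holds` (hilbert6.S20 (ii))

The velocity-reversed Boltzmann flow `f̃(τ, x, v) = f(t₁ - τ, x, -v)` of a mild solution `f` of
the hard-sphere Boltzmann equation on `[0, T]`, `t₁ ≤ T`, is a mild solution on `[0, t₁]` of the
Boltzmann equation with the *negated* collision kernel (the "backward" Boltzmann equation;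
Cercignani–Illner–Pulvirenti 1994 §4.7, *The Emergence of Irreversibility*, pp. 95–97: the
operation `S** : f(x, ξ, t) ↦ f(x, -ξ, t)` of Fig. 8–9; the docstring of the fact says "§4.6",
in the printed book §4.6 is *Interpretation* and the irreversibility discussion is §4.7).
Proved for an arbitrary geometry (`IsMildBoltzmannSolutionOn.reversed`), the torus statement
being the special case `Torus.geometry d`. The argument is pure bookkeeping on Duhamel's
formula, with no analysis beyond additivity of the interval integral:

* *velocity reflection of the collision operator*: for the hard-sphere kernel,
  `Q(h ∘ neg, g ∘ neg)(v) = Q(h, g)(-v)` (`collisionOp_comp_neg`), because the collision law is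
  linear in the velocity pair (`collide_neg_pair : collide ω (-p) = -collide ω p`), the kernel
  `((v - v_*)·ω)_+` is invariant under `(v, v_*, ω) ↦ (-v, -v_*, -ω)`
  (`hardSphereKernel_neg_neg`), Lebesgue measure is invariant under `v_* ↦ -v_*`
  (`integral_neg_eq_self`) and the surface measure under `ω ↦ -ω`
  (`Literature.Analysis.FluidPDE.integral_comp_neg_sphere`); no integrability is needed, both
  sides being the same Bochner integrals after a measure-preserving change of variables;
* hence the collision term of `f̃` for the kernel `-B` along the free characteristic through
  `(x, v)` at time `σ` is *minus* the collision term of `f` along the characteristic through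
  `(x + t₁ v, -v)` at time `t₁ - σ` (`alongFlow_collisionTerm_reversedSolution`);
* Duhamel's formula for `f` along that characteristic at the two times `t₁ - τ ≤ t₁`,
  subtracted (`intervalIntegral.integral_interval_sub_left`) and reparametrised by
  `s = t₁ - σ` (`intervalIntegral.integral_comp_sub_left`), is Duhamel's formula for `f̃` at
  time `τ` with the kernel `-B`.

## 3. `collisionOp_eq_zero_of_reversedSolution_holds` (hilbert6.S20 (iii), the negative clause)

If, for `f ∈ C([0, T]; X_β)` (`β > 0`) a mild hard-sphere Boltzmann solution on `T^d` and
`0 < t₁ ≤ T`, the reversed flow `f̃` is *also* a mild solution of the forward equation on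
`[0, t₁]`, then `Q(f, f) ≡ 0` on `[0, t₁] × T^d × ℝ^d` (CIP 1994 §4.7 pp. 95–97, Fig. 8–9 and
(7.1): `T_t S** T_t f₀ = S** f₀` is impossible away from equilibrium — there via the `H`-theorem;
BGSS 2018 §1). The Lean statement is the Duhamel-level form of this obstruction and is proved
directly, without the `H`-theorem:

* by § 2, `f̃` is a mild solution for the kernel `-B` (`IsMildBoltzmannSolutionOn.reversed`);
  comparing its Duhamel formula with the hypothesised one for `+B` along the characteristic
  through `(x, v)` gives `∫₀^τ φ = -∫₀^τ φ = 0` for all `τ ∈ [0, t₁]`, where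
  `φ(s) = Q(f, f)(t₁ - s, x + s v, -v)` (`collisionTerm_reversedSolution`);
* `continuousOn_collisionOpWith_param`: for `F ∈ C(S; X_β)` (continuous slices of finite
  Gaussian weighted sup norm, continuous in time in that norm) and a *continuous* Grad cut-off
  kernel, `(t, x, v) ↦ Q_B(F(t, x, ·), F(t, x, ·))(v)` is jointly continuous on `S × X × E`
  (joint continuity of `F`, `continuousOn_of_tendsto_eGaussSupNorm`; a locally uniform Gaussian
  bound, `eventually_abs_le_of_tendsto_eGaussSupNorm`; dominated convergence twice — over the
  sphere with a constant bound, then over `v_*` with the bound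
  `2 K M² (2 + |v₀|) (1 + |v_*|) e^{-β|v_*|²/2}` from
  `Literature.Analysis.FluidPDE.abs_gain_le_and_abs_loss_le`; the qualitative content of the
  continuity estimates of GST 2013 Part II Ch. 5). Hence `φ` is continuous on `[0, t₁]`;
* a continuous function all of whose primitives `∫₀^τ φ`, `τ ∈ [0, t₁]`, vanish is zero on
  `[0, t₁]` (FTC within `Icc 0 t₁`, `intervalIntegral.integral_hasDerivWithinAt_right` with the
  filter `FTCFilter.nhdsIcc`, and uniqueness of derivatives on an interval of positive length,
  `uniqueDiffOn_Icc` — this is where `0 < t₁` enters); finally every `(τ, x, v)`, `τ ∈ [0, t₁]`,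
  lies on such a reflected characteristic.

## References

* I. Gallagher, L. Saint-Raymond, B. Texier, *From Newton to Boltzmann: hard spheres and
  short-range potentials*, Zurich Lectures in Advanced Mathematics, EMS (2013), §2.4; §2.1
  (mild solutions) and Part II Ch. 5 (continuity estimates for the collision operator) for 3.
* A.-S. Sznitman, *Topics in propagation of chaos*, LNM 1464 (1991), Prop. 2.2.
* C. Cercignani, R. Illner, M. Pulvirenti, *The Mathematical Theory of Dilute Gases*, Applied
  Mathematical Sciences 106, Springer (1994), §4.7 pp. 95–97 (velocity inversion `S`, `S*`,
  `S**` and the diagrams of Fig. 8–9).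
* T. Bodineau, I. Gallagher, L. Saint-Raymond, S. Simonella, *One-sided convergence in the
  Boltzmann–Grad limit*, Ann. Fac. Sci. Toulouse Math. (6) 27 (2018) 985–1022, §1.
-/

open MeasureTheory Set Filter Topology

namespace Literature.MathematicalPhysics.KineticTheory

noncomputable section

variable {d : Type*} [Fintype d]

/-- **hilbert6.S08** (mode A ⇒ mode B on the torus; GST 2013 §2.4, Sznitman 1991 Prop. 2.2
(i)⇒(ii)): discharge of the named fact `propagatesChaos_imp_tendstoEmpirical_torus`, exactly as
stated. Proof: `PropagatesChaos` is by definition mode-A convergence to the tensorised family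
`f(t)^{⊗s}`, so this is the prelude's `TendstoMarginals.tendstoEmpirical` (discharged as
`TendstoMarginals.tendstoEmpirical_holds`) at `X = UnitAddTorus d`, with the standing hypothesis
"points of `T^d` are Lebesgue-null" supplied by `nullSingletonClass_volume_unitAddTorus`. [cite: GST2013, §2.4] -/
theorem propagatesChaos_imp_tendstoEmpirical_torus_holds :
    propagatesChaos_imp_tendstoEmpirical_torus (d := d) := by
  intro _ Nk εk hN Φk Wk hWs hWm hW0 hWD hW1 f T hf0 hf1 h
  haveI := Literature.Analysis.FluidPDE.nullSingletonClass_volume_unitAddTorus d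
  exact Literature.Analysis.FluidPDE.TendstoMarginals.tendstoEmpirical_holds hN Φk hWs hWm hW0
    hWD hW1 hf0 hf1 h

/-! ## Velocity reflection of the hard-sphere collision operator -/

section VelocityReflection

open Metric

variable {E : Type*} [NormedAddCommGroup E] [InnerProductSpace ℝ E]

/-- The elastic collision law is linear in the velocity pair (for a fixed impact direction):
`collide ω (-p) = -collide ω p`. [folklore] -/
theorem collide_neg_pair (ω : sphere (0 : E) 1) (p : E × E) : collide ω (-p) = -collide ω p := by
  obtain ⟨v, w⟩ := p
  have h : -v - -w = -(v - w) := by abel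
  simp only [collide, Prod.neg_mk, h, inner_neg_left, neg_smul, Prod.mk.injEq]
  constructor <;> abel

/-- The hard-sphere kernel `((v - v_*)·ω)_+` is invariant under the simultaneous reflection
`(v, v_*, ω) ↦ (-v, -v_*, -ω)`. [folklore] -/
theorem hardSphereKernel_neg_neg (p : E × E) (ω : sphere (0 : E) 1) :
    hardSphereKernel (-p) (-ω) = hardSphereKernel p ω := by
  have h : -p.1 - -p.2 = -(p.1 - p.2) := by abel
  simp only [hardSphereKernel, Prod.fst_neg, Prod.snd_neg, h, coe_neg_sphere, inner_neg_left,
    inner_neg_right, neg_neg]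

/-- The hard-sphere collision integrand of the reflected densities is the reflected integrand:
`B(v, v_*, ω) [f̌' ǧ_*' - f̌ ǧ_*] = (B [f' g_*' - f g_*])(-v, -v_*, -ω)` for `f̌ = f ∘ neg`,
`ǧ = g ∘ neg`. [folklore] -/
theorem collisionIntegrand_comp_neg (f g : E → ℝ) (p : E × E) (ω : sphere (0 : E) 1) :
    collisionIntegrand (fun u => f (-u)) (fun u => g (-u)) p ω =
      collisionIntegrand f g (-p) (-ω) := by
  simp only [collisionIntegrand, hardSphereKernel_neg_neg, Literature.Analysis.FluidPDE.collide_neg_dir,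
    collide_neg_pair, Prod.fst_neg, Prod.snd_neg]

variable [FiniteDimensional ℝ E] [MeasurableSpace E] [BorelSpace E]

/-- **Velocity reflection of the hard-sphere collision operator**:
`Q(f ∘ neg, g ∘ neg)(v) = Q(f, g)(-v)` (change of variables `v_* ↦ -v_*`, `ω ↦ -ω`, under which
Lebesgue measure, the surface measure of the sphere and the hard-sphere kernel are invariant;
CIP 1994 §4.7, the operation `S**`). No integrability is needed: both sides are the same Bochner
integrals after a measure-preserving change of variables. [folklore] -/
theorem collisionOp_comp_neg (f g : E → ℝ) (v : E) :
    collisionOp (fun u => f (-u)) (fun u => g (-u)) v = collisionOp f g (-v) := by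
  simp only [collisionOp]
  have h1 : ∀ w : E, ∫ ω, collisionIntegrand (fun u => f (-u)) (fun u => g (-u)) (v, w) ω ∂sphereMeasure
      = ∫ ω, collisionIntegrand f g (-v, -w) ω ∂sphereMeasure := by
    intro w
    rw [← Literature.Analysis.FluidPDE.integral_comp_neg_sphere
      (fun ω => collisionIntegrand f g (-v, -w) ω)]
    congr 1 with ω
    rw [collisionIntegrand_comp_neg, Prod.neg_mk]
  simp_rw [h1]
  exact integral_neg_eq_self (fun w => ∫ ω, collisionIntegrand f g (-v, w) ω ∂sphereMeasure) volume

/-- The collision operator is odd in the kernel: `Q_{-B}(f, g) = -Q_B(f, g)`. [folklore] -/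
theorem _root_.Literature.Analysis.FluidPDE.collisionOpWith_neg (B : E × E → sphere (0 : E) 1 → ℝ)
    (f g : E → ℝ) :
    Literature.Analysis.FluidPDE.collisionOpWith (-B) f g =
      -Literature.Analysis.FluidPDE.collisionOpWith B f g := by
  funext v
  simp only [Literature.Analysis.FluidPDE.collisionOpWith, Pi.neg_apply, neg_mul, integral_neg]

end VelocityReflection

/-! ## hilbert6.S20 (ii): the reversed flow solves the backward Boltzmann equation -/

section Reversed

open Metric

variable {X : Type*}

omit [Fintype d] in
/-- The frozen velocity profile of the reversed flow: `f̃(σ, y, ·) = f(t₁ - σ, y, -·)`.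
[folklore] -/
theorem reversedSolution_apply (f : ℝ → X → EuclideanSpace ℝ d → ℝ) (t₁ σ : ℝ) (y : X) :
    reversedSolution f t₁ σ y = fun v => f (t₁ - σ) y (-v) := rfl

/-- The collision term of the reversed flow for the negated hard-sphere kernel is minus the
velocity-reflected collision term of `f` at the reflected time:
`Q_{-B}(f̃, f̃)(σ, y, v) = -Q_B(f, f)(t₁ - σ, y, -v)`. [folklore] -/
theorem collisionTerm_neg_reversedSolution (f : ℝ → X → EuclideanSpace ℝ d → ℝ) (t₁ σ : ℝ)
    (y : X) (v : EuclideanSpace ℝ d) :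
    Literature.Analysis.FluidPDE.collisionTerm (-hardSphereKernel) (reversedSolution f t₁) σ y v =
      -Literature.Analysis.FluidPDE.collisionTerm hardSphereKernel f (t₁ - σ) y (-v) := by
  simp only [Literature.Analysis.FluidPDE.collisionTerm,
    Literature.Analysis.FluidPDE.collisionOpWith_neg, Pi.neg_apply,
    Literature.Analysis.FluidPDE.collisionOpWith_hardSphereKernel, reversedSolution_apply]
  rw [collisionOp_comp_neg (f (t₁ - σ) y) (f (t₁ - σ) y) v]

/-- Along the free characteristic through `(x, v)`, the `(-B)`-collision term of the reversed
flow at time `σ` is minus the `B`-collision term of `f` along the characteristic through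
`(x + t₁ v, -v)` at time `t₁ - σ` (both sit at the point `x + σ v`). [folklore] -/
theorem alongFlow_collisionTerm_reversedSolution (G : Literature.Analysis.FluidPDE.Geometry d X)
    (f : ℝ → X → EuclideanSpace ℝ d → ℝ) (t₁ σ : ℝ) (x : X) (v : EuclideanSpace ℝ d) :
    Literature.Analysis.FluidPDE.alongFlow G
        (Literature.Analysis.FluidPDE.collisionTerm (-hardSphereKernel) (reversedSolution f t₁)) σ x v =
      -Literature.Analysis.FluidPDE.alongFlow G
        (Literature.Analysis.FluidPDE.collisionTerm hardSphereKernel f) (t₁ - σ)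
          (G.translate x (t₁ • v)) (-v) := by
  simp only [Literature.Analysis.FluidPDE.alongFlow, Literature.Analysis.FluidPDE.Geometry.translate_add,
    collisionTerm_neg_reversedSolution]
  rw [show t₁ • v + (t₁ - σ) • -v = σ • v by rw [smul_neg, sub_smul]; abel]

/-- **The reversed flow is a mild solution of the backward Boltzmann equation**, on an arbitrary
geometry (torus or whole space): if `f` is a mild solution of the hard-sphere Boltzmann equation
on `[0, T]` and `t₁ ≤ T`, then `f̃(τ, x, v) = f(t₁ - τ, x, -v)` is a mild solution on `[0, t₁]`
for the negated kernel `-((v - v_*)·ω)_+` (CIP 1994 §4.7 pp. 95–97; vacuous for `t₁ < 0`).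
[cite: CIP1994, §4.7 pp. 95–97] -/
theorem _root_.Literature.Analysis.FluidPDE.IsMildBoltzmannSolutionOn.reversed
    {G : Literature.Analysis.FluidPDE.Geometry d X} {T t₁ : ℝ} (ht₁ : t₁ ≤ T)
    {f : ℝ → X → EuclideanSpace ℝ d → ℝ}
    (hf : Literature.Analysis.FluidPDE.IsMildBoltzmannSolutionOn T G hardSphereKernel f) :
    Literature.Analysis.FluidPDE.IsMildBoltzmannSolutionOn t₁ G (-hardSphereKernel)
      (reversedSolution f t₁) where
  nonneg τ hτ x v := hf.nonneg (t₁ - τ) ⟨sub_nonneg.2 hτ.2, (sub_le_self t₁ hτ.1).trans ht₁⟩ x (-v)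
  intervalIntegrable x v τ hτ := by
    have ht₁0 : 0 ≤ t₁ := hτ.1.trans hτ.2
    have hI := hf.intervalIntegrable (G.translate x (t₁ • v)) (-v) t₁ ⟨ht₁0, ht₁⟩
    have hI' : IntervalIntegrable (fun s => Literature.Analysis.FluidPDE.alongFlow G
        (Literature.Analysis.FluidPDE.collisionTerm hardSphereKernel f) s (G.translate x (t₁ • v)) (-v))
        volume t₁ (t₁ - τ) :=
      hI.mono_set (by
        rw [uIcc_of_le ht₁0, uIcc_of_ge (sub_le_self t₁ hτ.1)]
        exact Icc_subset_Icc (sub_nonneg.2 hτ.2) le_rfl)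
    have h2 := (hI'.comp_sub_left t₁).neg
    rw [sub_self, sub_sub_cancel] at h2
    have key : (fun σ => Literature.Analysis.FluidPDE.alongFlow G
        (Literature.Analysis.FluidPDE.collisionTerm (-hardSphereKernel) (reversedSolution f t₁)) σ x v) =
        -(fun σ => Literature.Analysis.FluidPDE.alongFlow G
          (Literature.Analysis.FluidPDE.collisionTerm hardSphereKernel f) (t₁ - σ)
            (G.translate x (t₁ • v)) (-v)) := by
      funext σ
      rw [Pi.neg_apply, alongFlow_collisionTerm_reversedSolution]
    rw [key]
    exact h2
  duhamel x v τ hτ := by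
    have ht₁0 : 0 ≤ t₁ := hτ.1.trans hτ.2
    have hτ' : t₁ - τ ∈ Icc 0 T := ⟨sub_nonneg.2 hτ.2, (sub_le_self t₁ hτ.1).trans ht₁⟩
    have hA := hf.duhamel (G.translate x (t₁ • v)) (-v) t₁ ⟨ht₁0, ht₁⟩
    have hB := hf.duhamel (G.translate x (t₁ • v)) (-v) (t₁ - τ) hτ'
    have hsub := intervalIntegral.integral_interval_sub_left
      (hf.intervalIntegrable (G.translate x (t₁ • v)) (-v) t₁ ⟨ht₁0, ht₁⟩)
      (hf.intervalIntegrable (G.translate x (t₁ • v)) (-v) (t₁ - τ) hτ')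
    have eA : Literature.Analysis.FluidPDE.alongFlow G f t₁ (G.translate x (t₁ • v)) (-v) =
        f t₁ x (-v) := by
      simp only [Literature.Analysis.FluidPDE.alongFlow, Literature.Analysis.FluidPDE.Geometry.translate_add,
        smul_neg, add_neg_cancel, Literature.Analysis.FluidPDE.Geometry.translate_zero]
    have eB : Literature.Analysis.FluidPDE.alongFlow G f (t₁ - τ) (G.translate x (t₁ • v)) (-v) =
        f (t₁ - τ) (G.translate x (τ • v)) (-v) := by
      simp only [Literature.Analysis.FluidPDE.alongFlow, Literature.Analysis.FluidPDE.Geometry.translate_add]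
      rw [show t₁ • v + (t₁ - τ) • -v = τ • v by rw [smul_neg, sub_smul]; abel]
    rw [eA] at hA
    rw [eB] at hB
    have hint : (∫ σ in (0 : ℝ)..τ, Literature.Analysis.FluidPDE.alongFlow G
        (Literature.Analysis.FluidPDE.collisionTerm (-hardSphereKernel) (reversedSolution f t₁)) σ x v) =
        -∫ s in (t₁ - τ)..t₁, Literature.Analysis.FluidPDE.alongFlow G
          (Literature.Analysis.FluidPDE.collisionTerm hardSphereKernel f) s (G.translate x (t₁ • v)) (-v) := by
      simp_rw [alongFlow_collisionTerm_reversedSolution]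
      rw [intervalIntegral.integral_neg, intervalIntegral.integral_comp_sub_left
        (fun s => Literature.Analysis.FluidPDE.alongFlow G
          (Literature.Analysis.FluidPDE.collisionTerm hardSphereKernel f) s (G.translate x (t₁ • v)) (-v)) t₁,
        sub_zero]
    have eL : Literature.Analysis.FluidPDE.alongFlow G (reversedSolution f t₁) τ x v =
        f (t₁ - τ) (G.translate x (τ • v)) (-v) := rfl
    have e0 : reversedSolution f t₁ 0 x v = f t₁ x (-v) := by
      simp only [reversedSolution, sub_zero]
    rw [eL, e0, hint, ← hsub]
    linarith

/-- **hilbert6.S20** (ii), discharge of the named fact `isMildBoltzmannSolutionOn_reversed`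
(Cercignani–Illner–Pulvirenti 1994 §4.7, pp. 95–97): on the torus `T^d`, the reversed flow
`f̃(τ, x, v) = f(t₁ - τ, x, -v)` of a mild hard-sphere Boltzmann solution `f` on `[0, T]`,
`t₁ ≤ T`, is a mild solution on `[0, t₁]` of the Boltzmann equation with the negated kernel.
The torus case of `IsMildBoltzmannSolutionOn.reversed`. [cite: CIP1994, §4.7 pp. 95–97] -/
theorem isMildBoltzmannSolutionOn_reversed_holds : isMildBoltzmannSolutionOn_reversed (d := d) :=
  fun ht₁ _ hf => hf.reversed ht₁

end Reversed

/-! ## Joint continuity of the collision term in Lanford's class -/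

section Continuity

open Metric Real Function Literature.Analysis.FluidPDE
open scoped ENNReal

variable {E : Type*} [NormedAddCommGroup E] {X : Type*}

/-- **Joint continuity in `C(S; X_β)`.** If every slice `F(t)`, `t ∈ S`, is jointly continuous in
`(x, v)` and `t ↦ F(t)` is continuous on `S` in the Gaussian weighted sup norm `‖·‖_β`, `β ≥ 0`
(which dominates the sup norm), then `(t, x, v) ↦ F(t, x, v)` is jointly continuous on
`S × X × E`. [folklore] -/
theorem continuousOn_of_tendsto_eGaussSupNorm [TopologicalSpace X] {S : Set ℝ} {β : ℝ}
    (hβ : 0 ≤ β) {F : ℝ → X → E → ℝ} (hc : ∀ t ∈ S, Continuous (uncurry (F t)))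
    (ht : ∀ t₀ ∈ S, Tendsto (fun t => eGaussSupNorm β (F t - F t₀)) (𝓝[S] t₀) (𝓝 0)) :
    ContinuousOn (fun q : ℝ × X × E => F q.1 q.2.1 q.2.2) (S ×ˢ univ) := by
  rintro ⟨t₀, z₀⟩ ⟨ht₀ : t₀ ∈ S, -⟩
  rw [ContinuousWithinAt, nhdsWithin_prod_eq, nhdsWithin_univ, Metric.tendsto_nhds]
  intro ε hε
  have h1 : ∀ᶠ t in 𝓝[S] t₀, ∀ z : X × E, dist (F t z.1 z.2) (F t₀ z.1 z.2) < ε / 2 := by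
    have hlt : (0 : ℝ≥0∞) < ENNReal.ofReal (ε / 2) := ENNReal.ofReal_pos.2 (half_pos hε)
    filter_upwards [(tendsto_order.1 (ht t₀ ht₀)).2 _ hlt] with t hts z
    have h1le : (1 : ℝ≥0∞) ≤ ENNReal.ofReal (exp (β / 2 * ‖z.2‖ ^ 2)) := by
      rw [← ENNReal.ofReal_one]
      exact ENNReal.ofReal_le_ofReal (one_le_exp (by positivity))
    have h2 : ‖(F t - F t₀) z.1 z.2‖ₑ < ENNReal.ofReal (ε / 2) :=
      lt_of_le_of_lt (le_mul_of_one_le_left zero_le h1le)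
        ((enorm_le_eGaussSupNorm β (F t - F t₀) z.1 z.2).trans_lt hts)
    rw [Pi.sub_apply, Pi.sub_apply, Real.enorm_eq_ofReal_abs,
      ENNReal.ofReal_lt_ofReal_iff (half_pos hε)] at h2
    rwa [Real.dist_eq]
  have h2 : ∀ᶠ z in 𝓝 z₀, dist (F t₀ z.1 z.2) (F t₀ z₀.1 z₀.2) < ε / 2 :=
    Metric.tendsto_nhds.1 ((hc t₀ ht₀).tendsto z₀) _ (half_pos hε)
  filter_upwards [h1.prod_mk h2] with p hp
  calc dist (F p.1 p.2.1 p.2.2) (F t₀ z₀.1 z₀.2)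
      ≤ dist (F p.1 p.2.1 p.2.2) (F t₀ p.2.1 p.2.2) + dist (F t₀ p.2.1 p.2.2) (F t₀ z₀.1 z₀.2) :=
        dist_triangle _ _ _
    _ < ε / 2 + ε / 2 := add_lt_add (hp.1 p.2) hp.2
    _ = ε := add_halves ε

/-- **Locally uniform Gaussian bound in `C(S; X_β)`**: near `t₀` within `S`,
`|F(t, x, v)| ≤ (‖F(t₀)‖_β + 1) e^{-β|v|²/2}`. [folklore] -/
theorem eventually_abs_le_of_tendsto_eGaussSupNorm {S : Set ℝ} {β : ℝ}
    {F : ℝ → X → E → ℝ} {t₀ : ℝ} (hfin : eGaussSupNorm β (F t₀) < ∞)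
    (ht : Tendsto (fun t => eGaussSupNorm β (F t - F t₀)) (𝓝[S] t₀) (𝓝 0)) :
    ∀ᶠ t in 𝓝[S] t₀, ∀ x u,
      |F t x u| ≤ ((eGaussSupNorm β (F t₀)).toReal + 1) * exp (-(β / 2) * ‖u‖ ^ 2) := by
  filter_upwards [(tendsto_order.1 ht).2 1 one_pos] with t hts x u
  have hA : exp (β / 2 * ‖u‖ ^ 2) * |F t₀ x u| ≤ (eGaussSupNorm β (F t₀)).toReal := by
    have h1 := enorm_le_eGaussSupNorm β (F t₀) x u
    rw [← ENNReal.ofReal_le_iff_le_toReal hfin.ne, ENNReal.ofReal_mul (exp_pos _).le,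
      ← Real.enorm_eq_ofReal_abs]
    exact h1
  have hB : exp (β / 2 * ‖u‖ ^ 2) * |F t x u - F t₀ x u| ≤ 1 := by
    have h1 := (enorm_le_eGaussSupNorm β (F t - F t₀) x u).trans_lt hts
    rw [Pi.sub_apply, Pi.sub_apply, Real.enorm_eq_ofReal_abs,
      ← ENNReal.ofReal_mul (exp_pos _).le, ← ENNReal.ofReal_one,
      ENNReal.ofReal_lt_ofReal_iff one_pos] at h1
    exact h1.le
  have hC : exp (β / 2 * ‖u‖ ^ 2) * |F t x u| ≤ (eGaussSupNorm β (F t₀)).toReal + 1 := by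
    have h3 : |F t x u| ≤ |F t₀ x u| + |F t x u - F t₀ x u| := by
      have := abs_add_le (F t₀ x u) (F t x u - F t₀ x u)
      rwa [add_sub_cancel] at this
    calc exp (β / 2 * ‖u‖ ^ 2) * |F t x u|
        ≤ exp (β / 2 * ‖u‖ ^ 2) * (|F t₀ x u| + |F t x u - F t₀ x u|) := by gcongr
      _ ≤ (eGaussSupNorm β (F t₀)).toReal + 1 := by rw [mul_add]; exact add_le_add hA hB
  rw [show -(β / 2) * ‖u‖ ^ 2 = -(β / 2 * ‖u‖ ^ 2) by ring, Real.exp_neg, ← div_eq_mul_inv,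
    le_div_iff₀ (exp_pos _), mul_comm]
  exact hC

variable [InnerProductSpace ℝ E] [FiniteDimensional ℝ E] [MeasurableSpace E] [BorelSpace E]
  {B : E × E → sphere (0 : E) 1 → ℝ}

/-- **Joint continuity of the collision term in Lanford's class** (the qualitative content of the
continuity estimates for the collision operator, GST 2013 Part II Ch. 5). Let `B` be a
*continuous* Grad cut-off kernel, `β > 0`, and `F ∈ C(S; X_β)`: every slice `F(t)`, `t ∈ S`, is
continuous with `‖F(t)‖_β < ∞`, and `‖F(t) - F(t₀)‖_β → 0` as `t → t₀` within `S`. Then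
`(t, x, v) ↦ Q_B(F(t, x, ·), F(t, x, ·))(v)` is continuous on `S × X × E`. [cite: GST2013, Part II Ch. 5] -/
theorem continuousOn_collisionOpWith_param [TopologicalSpace X] [FirstCountableTopology X]
    (hB : IsGradCutoffKernel B) (hBc : Continuous (uncurry B)) {S : Set ℝ} {β : ℝ} (hβ : 0 < β)
    {F : ℝ → X → E → ℝ} (hc : ∀ t ∈ S, Continuous (uncurry (F t)))
    (hfin : ∀ t ∈ S, eGaussSupNorm β (F t) < ∞)
    (ht : ∀ t₀ ∈ S, Tendsto (fun t => eGaussSupNorm β (F t - F t₀)) (𝓝[S] t₀) (𝓝 0)) :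
    ContinuousOn (fun p : ℝ × X × E => collisionOpWith B (F p.1 p.2.1) (F p.1 p.2.1) p.2.2)
      (S ×ˢ univ) := by
  haveI := isFiniteMeasure_sphereMeasure (E := E)
  obtain ⟨K, hK0, hK⟩ := hB.exists_bound_nonneg
  have hG := continuousOn_of_tendsto_eGaussSupNorm hβ.le hc ht
  have hBc' : Continuous fun r : (E × E) × sphere (0 : E) 1 => B r.1 r.2 := hBc
  -- the parameter set of the inner integral: `((t, x, v), v_*)` with `t ∈ S`
  set 𝒮 : Set ((ℝ × X × E) × E) := (S ×ˢ univ) ×ˢ univ with h𝒮_def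
  -- the collision integrand as a function of the parameters `q = ((t, x, v), v_*)` and `ω`
  set I : (ℝ × X × E) × E → sphere (0 : E) 1 → ℝ := fun q ω =>
    B (q.1.2.2, q.2) ω *
      (F q.1.1 q.1.2.1 (collide ω (q.1.2.2, q.2)).1 * F q.1.1 q.1.2.1 (collide ω (q.1.2.2, q.2)).2 -
        F q.1.1 q.1.2.1 q.1.2.2 * F q.1.1 q.1.2.1 q.2) with hI_def
  -- (1) continuity of the integrand in the parameters, for a fixed impact direction
  have hIq : ∀ ω, ContinuousOn (fun q => I q ω) 𝒮 := by
    intro ω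
    have e0 : Continuous fun q : (ℝ × X × E) × E => B (q.1.2.2, q.2) ω :=
      hBc'.comp (f := fun q : (ℝ × X × E) × E => ((q.1.2.2, q.2), ω)) (by fun_prop)
    have e1 : ContinuousOn
        (fun q : (ℝ × X × E) × E => F q.1.1 q.1.2.1 (collide ω (q.1.2.2, q.2)).1) 𝒮 :=
      hG.comp (f := fun q : (ℝ × X × E) × E => (q.1.1, q.1.2.1, (collide ω (q.1.2.2, q.2)).1))
        (by fun_prop : Continuous _).continuousOn (fun q hq => ⟨hq.1.1, mem_univ _⟩)
    have e2 : ContinuousOn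
        (fun q : (ℝ × X × E) × E => F q.1.1 q.1.2.1 (collide ω (q.1.2.2, q.2)).2) 𝒮 :=
      hG.comp (f := fun q : (ℝ × X × E) × E => (q.1.1, q.1.2.1, (collide ω (q.1.2.2, q.2)).2))
        (by fun_prop : Continuous _).continuousOn (fun q hq => ⟨hq.1.1, mem_univ _⟩)
    have e3 : ContinuousOn (fun q : (ℝ × X × E) × E => F q.1.1 q.1.2.1 q.1.2.2) 𝒮 :=
      hG.comp (f := fun q : (ℝ × X × E) × E => (q.1.1, q.1.2.1, q.1.2.2))
        (by fun_prop : Continuous _).continuousOn (fun q hq => ⟨hq.1.1, mem_univ _⟩)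
    have e4 : ContinuousOn (fun q : (ℝ × X × E) × E => F q.1.1 q.1.2.1 q.2) 𝒮 :=
      hG.comp (f := fun q : (ℝ × X × E) × E => (q.1.1, q.1.2.1, q.2))
        (by fun_prop : Continuous _).continuousOn (fun q hq => ⟨hq.1.1, mem_univ _⟩)
    exact e0.continuousOn.mul ((e1.mul e2).sub (e3.mul e4))
  -- (1') continuity of the integrand in the impact direction, for fixed parameters in `𝒮`
  have hIω : ∀ q ∈ 𝒮, Continuous (I q) := by
    rintro ⟨⟨t, x, v⟩, w⟩ ⟨⟨hts, -⟩, -⟩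
    have hFt : Continuous (uncurry (F t)) := hc t hts
    have e0 : Continuous fun ω : sphere (0 : E) 1 => B (v, w) ω :=
      hBc'.comp (f := fun ω : sphere (0 : E) 1 => ((v, w), ω)) (by fun_prop)
    have e1 : Continuous fun ω : sphere (0 : E) 1 => F t x (collide ω (v, w)).1 :=
      hFt.comp (f := fun ω : sphere (0 : E) 1 => (x, (collide ω (v, w)).1)) (by fun_prop)
    have e2 : Continuous fun ω : sphere (0 : E) 1 => F t x (collide ω (v, w)).2 :=
      hFt.comp (f := fun ω : sphere (0 : E) 1 => (x, (collide ω (v, w)).2)) (by fun_prop)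
    exact e0.mul ((e1.mul e2).sub continuous_const)
  -- (2) continuity of the sphere integral in the parameters (dominated convergence, constant bound)
  have hJ : ContinuousOn (fun q => ∫ ω, I q ω ∂sphereMeasure) 𝒮 := by
    rintro ⟨⟨t₀, x₀, v₀⟩, w₀⟩ hq₀
    obtain ⟨⟨ht₀ : t₀ ∈ S, -⟩, -⟩ := hq₀
    set M : ℝ := (eGaussSupNorm β (F t₀)).toReal + 1 with hM_def
    have hM0 : 0 ≤ M := by positivity
    have hT₁ : Tendsto (fun q : (ℝ × X × E) × E => q.1.1) (𝓝[𝒮] ((t₀, x₀, v₀), w₀)) (𝓝[S] t₀) :=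
      continuous_fst.fst.continuousWithinAt.tendsto_nhdsWithin fun q hq => hq.1.1
    have hT₂ : Tendsto (fun q : (ℝ × X × E) × E => (q.1.2.2, q.2)) (𝓝[𝒮] ((t₀, x₀, v₀), w₀))
        (𝓝 (v₀, w₀)) :=
      ((by fun_prop : Continuous fun q : (ℝ × X × E) × E => (q.1.2.2, q.2)).tendsto
        ((t₀, x₀, v₀), w₀)).mono_left nhdsWithin_le_nhds
    have hEM := hT₁.eventually (eventually_abs_le_of_tendsto_eGaussSupNorm (hfin t₀ ht₀) (ht t₀ ht₀))
    have hEB := hT₂.eventually (Metric.ball_mem_nhds (v₀, w₀) one_pos)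
    set C₀ : ℝ := K * (3 + ‖v₀‖ + ‖w₀‖) * (2 * M ^ 2) with hC₀_def
    refine continuousWithinAt_of_dominated (bound := fun _ => C₀) ?_ ?_ (integrable_const C₀) ?_
    · filter_upwards [self_mem_nhdsWithin] with q hq
      exact (hIω q hq).aestronglyMeasurable
    · filter_upwards [hEM, hEB] with q hqM hqB
      refine Eventually.of_forall fun ω => ?_
      obtain ⟨⟨t, x, v⟩, w⟩ := q
      simp only [Prod.dist_eq, max_lt_iff] at hqB
      have hv : ‖v‖ ≤ ‖v₀‖ + 1 := by
        have := norm_le_norm_add_norm_sub' v v₀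
        rw [← dist_eq_norm] at this
        linarith [hqB.1]
      have hw : ‖w‖ ≤ ‖w₀‖ + 1 := by
        have := norm_le_norm_add_norm_sub' w w₀
        rw [← dist_eq_norm] at this
        linarith [hqB.2]
      have hBvw : |B (v, w) ω| ≤ K * (3 + ‖v₀‖ + ‖w₀‖) := by
        rw [abs_of_nonneg (hB.nonneg _ _)]
        refine (hK (v, w) ω).trans ?_
        have : ‖v - w‖ ≤ ‖v‖ + ‖w‖ := norm_sub_le v w
        exact mul_le_mul_of_nonneg_left (by simp only; linarith) hK0
      have hF1 : ∀ u, |F t x u| ≤ M := fun u =>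
        (hqM x u).trans (mul_le_of_le_one_right hM0 (exp_le_one_iff.2
          (mul_nonpos_of_nonpos_of_nonneg (by linarith) (sq_nonneg _))))
      have hprod : ∀ a b : E, |F t x a * F t x b| ≤ M ^ 2 := fun a b => by
        rw [abs_mul, sq]
        exact mul_le_mul (hF1 a) (hF1 b) (abs_nonneg _) hM0
      rw [Real.norm_eq_abs, hI_def]
      dsimp only
      rw [abs_mul]
      refine mul_le_mul hBvw ((abs_sub _ _).trans ?_) (abs_nonneg _) (by positivity)
      linarith [hprod (collide ω (v, w)).1 (collide ω (v, w)).2, hprod v w]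
    · exact Eventually.of_forall fun ω => hIq ω _ ⟨⟨ht₀, mem_univ _⟩, mem_univ _⟩
  -- (3) continuity of the `v_*`-integral (dominated convergence, Gaussian bound)
  rintro ⟨t₀, x₀, v₀⟩ ⟨ht₀ : t₀ ∈ S, -⟩
  set M : ℝ := (eGaussSupNorm β (F t₀)).toReal + 1 with hM_def
  have hM0 : 0 ≤ M := by positivity
  set ψ : E → ℝ := fun u => (1 + ‖u‖) * exp (-(β / 2) * ‖u‖ ^ 2) with hψ_def
  have hψ : Integrable ψ := integrable_one_add_norm_mul_exp hβ
  set Sμ : ℝ := (sphereMeasure : Measure (sphere (0 : E) 1)).real univ with hSμ_def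
  set C₁ : ℝ := 2 * (K * M ^ 2) * (2 + ‖v₀‖) * Sμ with hC₁_def
  have hT₁ : Tendsto (fun p : ℝ × X × E => p.1) (𝓝[S ×ˢ univ] (t₀, x₀, v₀)) (𝓝[S] t₀) :=
    continuous_fst.continuousWithinAt.tendsto_nhdsWithin fun p hp => hp.1
  have hT₂ : Tendsto (fun p : ℝ × X × E => p.2.2) (𝓝[S ×ˢ univ] (t₀, x₀, v₀)) (𝓝 v₀) :=
    ((by fun_prop : Continuous fun p : ℝ × X × E => p.2.2).tendsto (t₀, x₀, v₀)).mono_left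
      nhdsWithin_le_nhds
  have hEM := hT₁.eventually (eventually_abs_le_of_tendsto_eGaussSupNorm (hfin t₀ ht₀) (ht t₀ ht₀))
  have hEB := hT₂.eventually (Metric.ball_mem_nhds v₀ one_pos)
  have hmaps : ∀ p ∈ S ×ˢ (univ : Set (X × E)), ∀ w : E, (p, w) ∈ 𝒮 := fun p hp w =>
    ⟨hp, mem_univ _⟩
  change ContinuousWithinAt (fun p : ℝ × X × E => ∫ w, ∫ ω, I (p, w) ω ∂sphereMeasure)
    (S ×ˢ univ) (t₀, x₀, v₀)
  refine continuousWithinAt_of_dominated (bound := fun w => C₁ * ψ w) ?_ ?_ (hψ.const_mul C₁) ?_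
  · filter_upwards [self_mem_nhdsWithin] with p hp
    have hcw : Continuous fun w : E => ∫ ω, I (p, w) ω ∂sphereMeasure := by
      rw [← continuousOn_univ]
      exact hJ.comp (f := fun w : E => (p, w)) (by fun_prop : Continuous _).continuousOn
        (fun w _ => hmaps p hp w)
    exact hcw.aestronglyMeasurable
  · filter_upwards [hEM, hEB] with p hpM hpB
    refine Eventually.of_forall fun w => ?_
    obtain ⟨t, x, v⟩ := p
    dsimp only at hpB
    have hv : ‖v‖ ≤ ‖v₀‖ + 1 := by
      have := norm_le_norm_add_norm_sub' v v₀
      rw [← dist_eq_norm] at this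
      linarith
    have hψv : ψ v ≤ 2 + ‖v₀‖ := by
      simp only [hψ_def]
      calc (1 + ‖v‖) * exp (-(β / 2) * ‖v‖ ^ 2) ≤ (1 + ‖v‖) * 1 := by
            gcongr
            exact exp_le_one_iff.2 (mul_nonpos_of_nonpos_of_nonneg (by linarith) (sq_nonneg _))
        _ ≤ 2 + ‖v₀‖ := by linarith
    have hD : ∀ ω, |I ((t, x, v), w) ω| ≤ 2 * (K * M ^ 2) * (2 + ‖v₀‖) * ψ w := by
      intro ω
      have h := abs_gain_le_and_abs_loss_le hB hK0 hK (hpM x) (v, w) ω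
      rw [hI_def]
      dsimp only
      rw [mul_sub]
      refine (abs_sub _ _).trans ?_
      have hψw : 0 ≤ ψ w := by positivity
      calc |B (v, w) ω * (F t x (collide ω (v, w)).1 * F t x (collide ω (v, w)).2)| +
            |B (v, w) ω * (F t x v * F t x w)|
          ≤ K * M ^ 2 * (ψ v * ψ w) + K * M ^ 2 * (ψ v * ψ w) := add_le_add h.1 h.2
        _ = 2 * (K * M ^ 2) * ψ v * ψ w := by ring
        _ ≤ 2 * (K * M ^ 2) * (2 + ‖v₀‖) * ψ w := by gcongr
    calc ‖∫ ω, I ((t, x, v), w) ω ∂sphereMeasure‖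
        ≤ ∫ ω, ‖I ((t, x, v), w) ω‖ ∂sphereMeasure := norm_integral_le_integral_norm _
      _ ≤ ∫ _ω, 2 * (K * M ^ 2) * (2 + ‖v₀‖) * ψ w ∂sphereMeasure :=
          integral_mono_of_nonneg (Eventually.of_forall fun _ => norm_nonneg _) (integrable_const _)
            (Eventually.of_forall fun ω => by dsimp only; rw [Real.norm_eq_abs]; exact hD ω)
      _ = C₁ * ψ w := by
          rw [integral_const, smul_eq_mul, hC₁_def, hSμ_def]
          ring
  · refine Eventually.of_forall fun w => ?_
    exact hJ.comp (f := fun p : ℝ × X × E => (p, w)) (by fun_prop : Continuous _).continuousOn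
      (fun p hp => hmaps p hp w) (t₀, x₀, v₀) ⟨ht₀, mem_univ _⟩

end Continuity

/-! ## hilbert6.S20 (iii): the negative clause -/

section Irreversibility

open Metric Real Function Literature.Analysis.FluidPDE

/-- The collision term of the velocity-reversed flow `f̃(τ, x, v) = f(t₁ - τ, x, -v)` for the
(un-negated) hard-sphere kernel is the reflected collision term of `f`:
`Q(f̃, f̃)(τ, x, v) = Q(f, f)(t₁ - τ, x, -v)` (from `collisionOp_comp_neg`). [folklore] -/
theorem collisionTerm_reversedSolution {X : Type*} (f : ℝ → X → EuclideanSpace ℝ d → ℝ)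
    (t₁ τ : ℝ) (x : X) (v : EuclideanSpace ℝ d) :
    collisionTerm hardSphereKernel (reversedSolution f t₁) τ x v =
      collisionTerm hardSphereKernel f (t₁ - τ) x (-v) := by
  simp only [collisionTerm, collisionOpWith_hardSphereKernel, reversedSolution_apply]
  exact collisionOp_comp_neg (f (t₁ - τ) x) (f (t₁ - τ) x) v

open Literature.Analysis.FunctionSpaces in
/-- **hilbert6.S20** (iii), discharge of the named fact `collisionOp_eq_zero_of_reversedSolution`
(Cercignani–Illner–Pulvirenti 1994 §4.7, pp. 95–97, Fig. 8–9 and (7.1); Bodineau–Gallagher–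
Saint-Raymond–Simonella 2018 §1): if `f ∈ C([0, T]; X_β)` (`β > 0`) is a mild solution of the
hard-sphere Boltzmann equation on `T^d`, `0 < t₁ ≤ T`, and the velocity-reversed flow
`f̃(τ, x, v) = f(t₁ - τ, x, -v)` is *also* a mild solution of the forward equation on `[0, t₁]`,
then `Q(f(τ, x, ·), f(τ, x, ·)) = 0` for all `τ ∈ [0, t₁]` and all `x, v`. Proof: `f̃` solves the
backward equation (`IsMildBoltzmannSolutionOn.reversed`), so comparing the two Duhamel formulas
gives `∫₀^τ φ = -∫₀^τ φ` for `φ(s) = Q(f, f)(t₁ - s, x + s v, -v)`; `φ` is continuous on `[0, t₁]`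
(`continuousOn_collisionOpWith_param`), hence vanishes identically (FTC within `Icc 0 t₁`); every
`(τ, x, v)` lies on such a reflected characteristic. [cite: CIP1994, §4.7 pp. 95–97 (7.1)] -/
theorem collisionOp_eq_zero_of_reversedSolution_holds :
    collisionOp_eq_zero_of_reversedSolution (d := d) := by
  intro T t₁ β hβ ht₁ f hfL hf hrev
  have hT : t₁ ≤ T := ht₁.2
  have ht₁0 : 0 < t₁ := ht₁.1
  -- joint continuity of the collision term on `[0, T] × T^d × ℝ^d`
  have hQc : ContinuousOn (fun p : ℝ × UnitAddTorus d × EuclideanSpace ℝ d =>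
      collisionTerm hardSphereKernel f p.1 p.2.1 p.2.2) (Icc 0 T ×ˢ univ) := by
    have hBc : Continuous (uncurry (hardSphereKernel (E := EuclideanSpace ℝ d))) := by
      unfold Function.uncurry hardSphereKernel
      fun_prop
    exact continuousOn_collisionOpWith_param isGradCutoffKernel_hardSphereKernel hBc hβ
      (fun t ht => (hfL.1 t ht).1) (fun t ht => (hfL.1 t ht).2) hfL.2
  -- the reversed flow solves the backward equation (hilbert6.S20 (ii))
  have hback := hf.reversed hT
  -- the main step: along every reflected characteristic the collision term vanishes
  have key : ∀ (x : UnitAddTorus d) (v : EuclideanSpace ℝ d), ∀ s ∈ Icc 0 t₁,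
      collisionTerm hardSphereKernel f (t₁ - s) (x + Torus.proj (s • v)) (-v) = 0 := by
    intro x v
    set φ : ℝ → ℝ := fun s =>
      collisionTerm hardSphereKernel f (t₁ - s) (x + Torus.proj (s • v)) (-v) with hφ_def
    -- continuity of `φ` on `[0, t₁]`
    have hφc : ContinuousOn φ (Icc 0 t₁) := by
      have hcts : Continuous fun s : ℝ => (t₁ - s, x + Torus.proj (s • v), -v) := by
        have := Torus.continuous_proj (d := d)
        fun_prop
      refine hQc.comp (f := fun s : ℝ => (t₁ - s, x + Torus.proj (s • v), -v))
        hcts.continuousOn fun s hs => ⟨⟨?_, ?_⟩, mem_univ _⟩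
      · linarith [hs.2]
      · linarith [hs.1]
    -- the primitives of `φ` vanish on `[0, t₁]`: forward versus backward Duhamel formula for `f̃`
    have hint : ∀ τ ∈ Icc 0 t₁, ∫ s in (0 : ℝ)..τ, φ s = 0 := by
      intro τ hτ
      have e1 := hrev.duhamel x v τ hτ
      have e2 := hback.duhamel x v τ hτ
      have e3 : ∫ s in (0 : ℝ)..τ, alongFlow (Torus.geometry d)
          (collisionTerm hardSphereKernel (reversedSolution f t₁)) s x v = ∫ s in (0 : ℝ)..τ, φ s := by
        refine intervalIntegral.integral_congr fun s _ => ?_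
        simp only [hφ_def, alongFlow, Torus.geometry_translate, collisionTerm_reversedSolution]
      have e4 : ∫ s in (0 : ℝ)..τ, alongFlow (Torus.geometry d)
          (collisionTerm (-hardSphereKernel) (reversedSolution f t₁)) s x v =
          -∫ s in (0 : ℝ)..τ, φ s := by
        rw [← intervalIntegral.integral_neg]
        refine intervalIntegral.integral_congr fun s _ => ?_
        simp only [hφ_def, alongFlow, Torus.geometry_translate, collisionTerm_neg_reversedSolution]
      rw [e3] at e1
      rw [e4] at e2
      linarith
    -- a continuous function with vanishing primitives vanishes (FTC within `Icc 0 t₁`)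
    intro s hs
    haveI : Fact (s ∈ Icc 0 t₁) := ⟨hs⟩
    have hU : UniqueDiffWithinAt ℝ (Icc 0 t₁) s := uniqueDiffOn_Icc ht₁0 s hs
    have hderiv : HasDerivWithinAt (fun u => ∫ r in (0 : ℝ)..u, φ r) (φ s) (Icc 0 t₁) s :=
      intervalIntegral.integral_hasDerivWithinAt_right
        ((hφc.mono (by rw [uIcc_of_le hs.1]; exact Icc_subset_Icc_right hs.2)).intervalIntegrable)
        (hφc.stronglyMeasurableAtFilter_nhdsWithin measurableSet_Icc s) (hφc s hs)
    have hzero : HasDerivWithinAt (fun u => ∫ r in (0 : ℝ)..u, φ r) 0 (Icc 0 t₁) s :=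
      (hasDerivWithinAt_const s (Icc 0 t₁) (0 : ℝ)).congr_of_mem (fun u hu => hint u hu) hs
    have h1 := hderiv.derivWithin hU
    rw [hzero.derivWithin hU] at h1
    exact h1.symm
  -- every `(τ, x, v)` with `τ ∈ [0, t₁]` lies on a reflected characteristic
  intro τ hτ x v
  have hs : t₁ - τ ∈ Icc 0 t₁ := ⟨by linarith [hτ.2], by linarith [hτ.1]⟩
  have h := key (x - Torus.proj ((t₁ - τ) • -v)) (-v) (t₁ - τ) hs
  rwa [sub_add_cancel, sub_sub_cancel, neg_neg] at h

end Irreversibility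

end

end Literature.MathematicalPhysics.KineticTheory
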